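import Summits.BirchSwinnertonDyer.BirchSwinnertonDyer.Theorems.KolyvaginRoadThreeSchneiderTamAtThreeHeightLogNumeratorExact
import Summits.BirchSwinnertonDyer.BirchSwinnertonDyer.Theorems.KolyvaginRoadThreeSchneiderTamAtThreeHeightLogNumeratorDeepCanonical
import HarnessLib

/-!
# Crux `SchneiderTamAtThree` (item 19154) — THE HEIGHT IS THE LOGARITHM OF THE NUMERATOR, DEEP POINTS,
# part 7c: the exact constant `κ_E = (C⁻²E₂(q) − b₂)/12` — integrality, its rational truncations,
# THE canonical datum, and the uniform certificate schema

HONEST FRAMING (cell `bsd-stepL`, seat `bsd-stepL-tam3-p2` g3, WIDTH-LEVER second lane «closed-form Schneider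
local factor at 3 … finite case table proved once»; `--supports stmt-BirchSwinnertonDyer-19154 --as helper`):
THEOREMS ONLY, unconditional, route-independent (no Theses import); 0 definitions, 0 named facts, 0 sorry;
nothing here proves the crux `SchneiderTamAtThree`, Schneider's conjecture or BSD.

Throughout `κ_E = (C⁻²·(1 − 24 s₁(q)) − b₂)/12` (`C² = uniformisationScaleSq W 3 q`, `s₁ = tateS 1`,
`E₂(q) = 1 − 24 s₁(q)`), `κ₀' = (b₂b₄ − 18b₆)/c₄`, all invariants of the minimal model read in `ℚ₃`.
* §19 `norm_kappaE_le_one` (`κ_E ∈ ℤ₃`), `norm_tateS_one_sub_self_le` (`‖s₁(q) − q‖ ≤ ‖q‖²`),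
  `norm_kappaE_add_kappa₀_le` (**`κ_E ≡ −κ₀' (mod q)`**), `norm_kappaE_add_kappa₀_add_linear_le`
  (**`κ_E ≡ −κ₀' − 60(c₆/c₄)q (mod q²)`**), `norm_kappaE_add_kappa₀_add_j_le` (Tate parameter: `q ↦ 1/j`):
  the deep-point laws of parts 3b / 6 / 6b (precisions `2k + min(2k, ν)`, `2k + min(2k, ν+1)`, `2k + min(2k, 2ν)`)
  are the exact law (part 7b, precision `4k`) with `κ_E` replaced by these RATIONAL truncations — the Kodaira
  type `I_ν` enters only through how well a rational number approximates the quasi-period constant `κ_E`.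
* §20 `norm_pairing_self_sub_exactForm_le_of_isMultCanonical` — THE canonical datum (`IsMultCanonical Dh q`):
  `‖⟨P,P⟩ − (log₃ a − κ_E·D/a)‖₃ ≤ ‖x‖₃⁻²` on admissible points of level `≥ 2`.
* §21 `norm_heightFourOneCoord_eq_of_proxy`, `heightFourOneCoord_ne_zero_of_proxy` — UNIFORM CERTIFICATE
  SCHEMA: any `κ̃ ∈ ℚ₃` with `‖κ̃ − κ_E‖ ≤ ‖x‖⁻¹` (e.g. a rational truncation of the `q`-series to `2k` digits)
  and `‖log₃ a − κ̃·D/a‖ > ‖x‖⁻²` give `‖ĥ₃(P)‖ = ‖log₃ a − κ̃·D/a‖ ≠ 0`; every one-congruence checker of parts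
  4 / 6b / 6d is the instance `κ̃ ∈ {−κ₀', −κ₀' − 60c₆Δ/c₄⁴}`. Since `v₃(ĥ₃(3^m P)) = v₃(ĥ₃(P)) + 2m` while the
  precision at `3^m P` is `4(k + m)`, EVERY curve with `ĥ₃ ≠ 0` is certified at some multiple `3^m P` from a
  rational approximation of `κ_E` — per pair the crux is a finite rational computation; class-wide it is the
  statement that `κ_E` avoids one `3`-adic value per curve (open, transcendence-type; RULING 20 (A)).

References: [SteinWuthrich2013] §4.1–4.2; [MazurTate1991] §1; [SilvermanATAEC1994] V.1 Rem. 1.2, V.3, V.5;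
tree: parts 1–7b, `…DeepCanonical`.
-/

noncomputable section

open scoped Classical Nat
open Filter Topology IsUltrametricDist PowerSeries
open WeierstrassCurve Literature.NumberTheory.EllipticCurves
open Literature.NumberTheory.EllipticCurves.SteinWuthrich2013
open Literature.NumberTheory.EllipticCurves.TateCurve
open Literature.NumberTheory.EllipticCurves.Rank1Residual
open Summit.BirchSwinnertonDyer.Uniform.UI.O2
open scoped ArithmeticFunction.sigma

namespace Summit.BirchSwinnertonDyer.Rank1Residual.X11b.RegMult.HeightLogNumerator

/-! ### §19 The exact constant `κ_E` and its rational truncations -/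

section KappaE

variable {W : WeierstrassCurve ℚ}

/-- **`κ_E = (C⁻²E₂(q) − b₂)/12` is a `3`-adic integer** at a multiplicative `3` (`‖q‖₃ < 1`): `C⁻²E₂(q)` is a
unit congruent to `b₂` modulo `3` (part 1's scale congruence `C² ≡ b₂ (mod 3)` and `E₂(q) ≡ 1 (mod 3q)`),
and `‖1/12‖₃ = 3`. [cite: SilvermanATAEC1994, Thm. V.3.1 (b)] -/
theorem norm_kappaE_le_one [W.IsElliptic] [W.IsGloballyMinimal] (hW : Mult W 3) {q : ℚ_[3]} (hq : ‖q‖ < 1) :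
    ‖((uniformisationScaleSq W 3 q)⁻¹ * (1 - 24 * tateS 1 q) - (W.baseChange ℚ_[3]).b₂) / 12‖ ≤ 1 := by
  obtain ⟨-, -, -, -, -, h12i, -, -, -, -⟩ := padic_three_constants
  have hC : ‖uniformisationScaleSq W 3 q‖ = 1 := norm_uniformisationScaleSq_eq_one hW hq
  have hCi : ‖(uniformisationScaleSq W 3 q)⁻¹‖ = 1 := by rw [norm_inv, hC, inv_one]
  have hq3 : ‖q‖ ≤ 3⁻¹ := (norm_le_inv_of_norm_lt_one hq).trans (by norm_num)
  have h := norm_lambertScale_sub_le hCi (norm_tateS_one_le hq) hq3 (norm_inv_scaleSq_sub_b₂_le hW hq)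
  rw [div_eq_mul_inv, norm_mul, h12i]
  calc _ * (3 : ℝ) ≤ (1 / 3) * 3 := by gcongr
    _ = 1 := by norm_num

/-- **`‖s₁(q) − q‖₃ ≤ ‖q‖₃²`** (`s₁(q) − q = Σ_{n≥2} σ₁(n)qⁿ`, each term of norm `≤ ‖q‖²`).
[cite: SilvermanATAEC1994, Thm. V.3.1 (a)] -/
theorem norm_tateS_one_sub_self_le {q : ℚ_[3]} (hq : ‖q‖ < 1) : ‖tateS 1 q - q‖ ≤ ‖q‖ ^ 2 := by
  have hS := hasSum_tateS 1 (K := ℚ_[3]) hq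
  have hS' := (hasSum_nat_add_iff' 1).mpr hS
  simp only [Finset.range_one, Finset.sum_singleton, zero_add, pow_one] at hS'
  have h1 : ((σ 1 1 : ℕ) : ℚ_[3]) * q = q := by
    rw [ArithmeticFunction.sigma_one_apply, Nat.divisors_one, Finset.sum_singleton, Nat.cast_one, one_mul]
  rw [h1] at hS'
  rw [← hS'.tsum_eq]
  refine IsUltrametricDist.norm_tsum_le_of_forall_le_of_nonneg (by positivity) fun n ↦ ?_
  rw [norm_mul, norm_pow]
  calc ‖((σ 1 (n + 1 + 1) : ℕ) : ℚ_[3])‖ * ‖q‖ ^ (n + 1 + 1) ≤ 1 * ‖q‖ ^ (n + 2) :=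
        mul_le_mul (norm_natCast_le_one _) le_rfl (by positivity) zero_le_one
    _ = ‖q‖ ^ n * ‖q‖ ^ 2 := by rw [one_mul, pow_add]
    _ ≤ 1 * ‖q‖ ^ 2 := by gcongr; exact pow_le_one₀ (norm_nonneg _) hq.le
    _ = ‖q‖ ^ 2 := one_mul _

/-- **`κ_E ≡ −κ₀' (mod q)`**: `‖κ_E + (b₂b₄ − 18b₆)/c₄‖₃ ≤ ‖q‖₃` (part 3a's `κ_C ≡ −κ₀' (mod q)` and
`‖2C⁻²s₁(q)‖ ≤ ‖q‖`). Substituted into the exact law (part 7b) this is the deep-point law of part 3b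
(precision `2k + min(2k, ν)`). [cite: SilvermanATAEC1994, Thm. V.3.1 (b)] -/
theorem norm_kappaE_add_kappa₀_le [W.IsElliptic] [W.IsGloballyMinimal] (hW : Mult W 3) {q : ℚ_[3]}
    (hq : ‖q‖ < 1) :
    ‖((uniformisationScaleSq W 3 q)⁻¹ * (1 - 24 * tateS 1 q) - (W.baseChange ℚ_[3]).b₂) / 12 +
        ((W.baseChange ℚ_[3]).b₂ * (W.baseChange ℚ_[3]).b₄ - 18 * (W.baseChange ℚ_[3]).b₆) /
          (W.baseChange ℚ_[3]).c₄‖ ≤ ‖q‖ := by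
  obtain ⟨h2n, -, -, -, -, -, -, -, -, -⟩ := padic_three_constants
  set C2 := uniformisationScaleSq W 3 q with hC2def
  set V := W.baseChange ℚ_[3] with hVdef
  set K := tateS 1 q with hKdef
  have hC : ‖C2‖ = 1 := norm_uniformisationScaleSq_eq_one hW hq
  have hCi : ‖C2⁻¹‖ = 1 := by rw [norm_inv, hC, inv_one]
  have hK : ‖K‖ ≤ ‖q‖ := norm_tateS_one_le hq
  have h0 := norm_kappa_sub_rational_le hW hq
  rw [← hC2def, ← hVdef] at h0
  have e : (C2⁻¹ * (1 - 24 * K) - V.b₂) / 12 + (V.b₂ * V.b₄ - 18 * V.b₆) / V.c₄ =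
      ((C2⁻¹ - V.b₂) / 12 - (18 * V.b₆ - V.b₂ * V.b₄) / V.c₄) - 2 * (C2⁻¹ * K) := by ring
  rw [e]
  refine (norm_sub_le_max₃ _ _).trans (max_le h0 ?_)
  rw [norm_mul, norm_mul, h2n, hCi, one_mul, one_mul]; exact hK

/-- **`κ_E ≡ −κ₀' − 60(c₆/c₄)q (mod q²)`**: `‖κ_E + (b₂b₄ − 18b₆)/c₄ + 60(c₆/c₄)q‖₃ ≤ ‖q‖₃²` (part 5's
`(C⁻² − b₂)/12 ≡ −κ₀' − 62(c₆/c₄)q`, part 3a's `C⁻² ≡ −c₆/c₄ (mod 3⁻¹q)` and `s₁(q) ≡ q (mod q²)`: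
`−62 + 2 = −60`). Substituted into the exact law this is the order-`q` law of part 6 (precision
`2k + min(2k, 2ν)` after `q ↦ 1/j`). [cite: SilvermanATAEC1994, Thm. V.3.1 (b)] -/
theorem norm_kappaE_add_kappa₀_add_linear_le [W.IsElliptic] [W.IsGloballyMinimal] (hW : Mult W 3)
    {q : ℚ_[3]} (hq : ‖q‖ < 1) :
    ‖((uniformisationScaleSq W 3 q)⁻¹ * (1 - 24 * tateS 1 q) - (W.baseChange ℚ_[3]).b₂) / 12 +
        ((W.baseChange ℚ_[3]).b₂ * (W.baseChange ℚ_[3]).b₄ - 18 * (W.baseChange ℚ_[3]).b₆) /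
          (W.baseChange ℚ_[3]).c₄ +
        60 * ((W.baseChange ℚ_[3]).c₆ / (W.baseChange ℚ_[3]).c₄) * q‖ ≤ ‖q‖ ^ 2 := by
  obtain ⟨h2n, -, -, -, -, -, -, -, -, -⟩ := padic_three_constants
  set C2 := uniformisationScaleSq W 3 q with hC2def
  set V := W.baseChange ℚ_[3] with hVdef
  set K := tateS 1 q with hKdef
  have hC : ‖C2‖ = 1 := norm_uniformisationScaleSq_eq_one hW hq
  have hCi : ‖C2⁻¹‖ = 1 := by rw [norm_inv, hC, inv_one]
  have h1 := norm_kappa_add_sub_linear_le hW hq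
  have h2 := norm_inv_scaleSq_add_c₆_div_c₄_le hW hq
  rw [← hC2def, ← hVdef] at h1 h2
  have h3 := norm_tateS_one_sub_self_le hq
  rw [← hKdef] at h3
  have e : (C2⁻¹ * (1 - 24 * K) - V.b₂) / 12 + (V.b₂ * V.b₄ - 18 * V.b₆) / V.c₄ + 60 * (V.c₆ / V.c₄) * q =
      ((C2⁻¹ - V.b₂) / 12 + (V.b₂ * V.b₄ - 18 * V.b₆) / V.c₄ + 62 * (V.c₆ / V.c₄) * q)
        - 2 * q * (C2⁻¹ + V.c₆ / V.c₄) - 2 * C2⁻¹ * (K - q) := by ring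
  rw [e]
  refine (norm_sub_le_max₃ _ _).trans (max_le ((norm_sub_le_max₃ _ _).trans (max_le h1 ?_)) ?_)
  · rw [norm_mul, norm_mul, h2n, one_mul]
    calc ‖q‖ * ‖C2⁻¹ + V.c₆ / V.c₄‖ ≤ ‖q‖ * (3⁻¹ * ‖q‖) := by gcongr
      _ = 3⁻¹ * ‖q‖ ^ 2 := by ring
      _ ≤ 1 * ‖q‖ ^ 2 := by gcongr; norm_num
      _ = ‖q‖ ^ 2 := one_mul _
  · rw [norm_mul, norm_mul, h2n, hCi, one_mul, one_mul]; exact h3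

/-- **The Tate-parameter form**: for `tateJ q = j(W)`, `‖κ_E + (b₂b₄ − 18b₆)/c₄ + 60(c₆/c₄)/j‖₃ ≤ ‖q‖₃²`
(`‖1/j − q‖ ≤ ‖q‖²`). With `1/j = Δ/c₄³`: `κ_E ≡ −[(b₂b₄ − 18b₆)/c₄ + 60c₆Δ/c₄⁴] (mod 3^{2v₃Δ})` — the rational
constant of parts 6b/6c/6d is the quasi-period constant to `2ν` digits.
[cite: SilvermanATAEC1994, Thm. V.3.1 (b), §V.5] -/
theorem norm_kappaE_add_kappa₀_add_j_le [W.IsElliptic] [W.IsGloballyMinimal] (hW : Mult W 3)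
    {q : ℚ_[3]} (hq : ‖q‖ < 1) (hj : tateJ q = (W.j : ℚ_[3])) :
    ‖((uniformisationScaleSq W 3 q)⁻¹ * (1 - 24 * tateS 1 q) - (W.baseChange ℚ_[3]).b₂) / 12 +
        ((W.baseChange ℚ_[3]).b₂ * (W.baseChange ℚ_[3]).b₄ - 18 * (W.baseChange ℚ_[3]).b₆) /
          (W.baseChange ℚ_[3]).c₄ +
        60 * ((W.baseChange ℚ_[3]).c₆ / (W.baseChange ℚ_[3]).c₄) * ((W.j : ℚ_[3]))⁻¹‖ ≤ ‖q‖ ^ 2 := by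
  set V := W.baseChange ℚ_[3] with hVdef
  have h1 := norm_kappaE_add_kappa₀_add_linear_le hW hq
  rw [← hVdef] at h1
  obtain ⟨hc4, hc6⟩ := norm_c₄_c₆_baseChange_eq_one (W := W) hW
  rw [← hVdef] at hc4 hc6
  have h60 : ‖(60 : ℚ_[3])‖ ≤ 1 := by
    have h : ((60 : ℤ) : ℚ_[3]) = 60 := by norm_cast
    rw [← h]; exact Padic.norm_int_le_one 60
  have hjq : ‖((W.j : ℚ_[3]))⁻¹ - q‖ ≤ ‖q‖ ^ 2 := by
    rw [← hj, sq]; exact norm_inv_tateJ_sub_le hq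
  have e : ((uniformisationScaleSq W 3 q)⁻¹ * (1 - 24 * tateS 1 q) - V.b₂) / 12 +
      (V.b₂ * V.b₄ - 18 * V.b₆) / V.c₄ + 60 * (V.c₆ / V.c₄) * ((W.j : ℚ_[3]))⁻¹ =
      (((uniformisationScaleSq W 3 q)⁻¹ * (1 - 24 * tateS 1 q) - V.b₂) / 12 +
        (V.b₂ * V.b₄ - 18 * V.b₆) / V.c₄ + 60 * (V.c₆ / V.c₄) * q) +
        60 * (V.c₆ / V.c₄) * (((W.j : ℚ_[3]))⁻¹ - q) := by ring
  rw [e]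
  refine (norm_add_le_max _ _).trans (max_le h1 ?_)
  rw [norm_mul, norm_mul, norm_div, hc4, hc6, div_one, mul_one]
  calc ‖(60 : ℚ_[3])‖ * ‖((W.j : ℚ_[3]))⁻¹ - q‖ ≤ 1 * ‖q‖ ^ 2 := by gcongr
    _ = ‖q‖ ^ 2 := one_mul _

end KappaE

/-! ### §20 THE canonical datum -/

section Canonical

variable {W : WeierstrassCurve ℚ}

/-- **THE canonical `3`-adic height of a deep admissible point, exact second order.** For `W/ℚ` globally
minimal with multiplicative reduction at `3`, `q ∈ ℚ₃` with `‖q‖₃ < 1`, a height datum `Dh` with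
`IsMultCanonical Dh q` (SW 2013 §4.2: `⟨P,P⟩ = ĥ₃(P)` by formula (4.1) on admissible points), and an
admissible rational point `P = (x, y)` with `3⁴ ∣ den x` (level `k ≥ 2`):
**`‖⟨P,P⟩ − (log₃ num x − κ_E·den x/num x)‖₃ ≤ ‖x‖₃⁻²`**, `κ_E = (C⁻²E₂(q) − b₂)/12`. For THE Tate parameter
(`tateJ q = j`) this is the statement the crux's deciding stub quantifies over, to `4k` digits.
[cite: SteinWuthrich2013, §4.1 eq. (4.1), §4.2] [cite: Schneider1982PadicHeightI, §1] -/
theorem norm_pairing_self_sub_exactForm_le_of_isMultCanonical [W.IsElliptic] [W.IsGloballyMinimal]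
    (hW : Mult W 3) {q : ℚ_[3]} (hq : ‖q‖ < 1) {Dh : PAdicHeightData W 3} (hDh : IsMultCanonical Dh q)
    {x y : ℚ} {h : W.toAffine.Nonsingular x y} (hadm : W.IsAdmissible 3 (.some x y h))
    (h4 : 4 ≤ padicValNat 3 x.den) :
    ‖Dh.pairing (.some x y h) (.some x y h) - (padicLog 3 ((x.num : ℚ) : ℚ_[3]) -
        ((uniformisationScaleSq W 3 q)⁻¹ * (1 - 24 * tateS 1 q) - (W.baseChange ℚ_[3]).b₂) / 12 *
          (((x.den : ℚ) : ℚ_[3]) / ((x.num : ℚ) : ℚ_[3])))‖ ≤ ‖(x : ℚ_[3])‖⁻¹ ^ 2 := by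
  have hx : 1 < ‖(x : ℚ_[3])‖ := hadm.2.1
  have hden : ‖(x : ℚ_[3])‖⁻¹ = (3 : ℝ) ^ (-(padicValNat 3 x.den : ℤ)) := by
    rw [← norm_den_eq_inv_norm hx, Rat.cast_natCast,
      Padic.norm_eq_zpow_neg_valuation (by exact_mod_cast x.den_nz), Padic.valuation_natCast]
    norm_cast
  have hz9 : ‖-(x : ℚ_[3]) / y‖ ≤ 1 / 9 := by
    obtain ⟨-, hz2⟩ := norm_neg_div_of_one_lt_norm (p := 3) h hx
    have hsq : ‖-(x : ℚ_[3]) / y‖ ^ 2 ≤ (1 / 9) ^ 2 := by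
      rw [hz2, hden]
      calc (3 : ℝ) ^ (-(padicValNat 3 x.den : ℤ)) ≤ (3 : ℝ) ^ (-(4 : ℤ)) := by
            apply zpow_le_zpow_right₀ (by norm_num); omega
        _ = (1 / 9) ^ 2 := by norm_num
    exact (pow_le_pow_iff_left₀ (norm_nonneg _) (by norm_num) two_ne_zero).mp hsq
  rw [hDh _ hadm, heightFourOne_some, ← sub_add]
  exact norm_heightFourOneCoord_sub_padicLog_num_add_kappaE_mul_le hW hq h hx hz9

/-- **Every admissible point, via its multiples.** For THE canonical datum (`IsMultCanonical Dh q`) the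
pairing is bilinear, so `⟨nP, nP⟩ = n²⟨P, P⟩`: if `n • P = (x', y')` is admissible of level `≥ 2`
(`3⁴ ∣ den x'`; e.g. `n = 3^m`, level `k + m`), then **`‖n²·⟨P,P⟩ − (log₃ num x' − κ_E·den x'/num x')‖₃ ≤
‖x'‖₃⁻²`**. For a point `P` of level `k ≥ 1` and `n = 3^m` this determines `⟨P,P⟩` to `3^{−(4k + 2m)}`: the
exact law decides `⟨P,P⟩ ≠ 0` for EVERY curve with `⟨P,P⟩ ≠ 0` at some finite `m`, given `κ_E` to `2(k+m)`
digits (§21). [cite: SteinWuthrich2013, §4.1 eq. (4.1), §4.2] [cite: MazurTateTeitelbaum1986Invent, §II.4] -/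
theorem norm_sq_mul_pairing_self_sub_exactForm_le_of_nsmul [W.IsElliptic] [W.IsGloballyMinimal]
    (hW : Mult W 3) {q : ℚ_[3]} (hq : ‖q‖ < 1) {Dh : PAdicHeightData W 3} (hDh : IsMultCanonical Dh q)
    (P : W.toAffine.Point) (n : ℕ) {x' y' : ℚ} {h' : W.toAffine.Nonsingular x' y'}
    (hnP : n • P = .some x' y' h') (hadm' : W.IsAdmissible 3 (.some x' y' h'))
    (h4' : 4 ≤ padicValNat 3 x'.den) :
    ‖(n : ℚ_[3]) ^ 2 * Dh.pairing P P - (padicLog 3 ((x'.num : ℚ) : ℚ_[3]) -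
        ((uniformisationScaleSq W 3 q)⁻¹ * (1 - 24 * tateS 1 q) - (W.baseChange ℚ_[3]).b₂) / 12 *
          (((x'.den : ℚ) : ℚ_[3]) / ((x'.num : ℚ) : ℚ_[3])))‖ ≤ ‖(x' : ℚ_[3])‖⁻¹ ^ 2 := by
  have hsq : (n : ℚ_[3]) ^ 2 * Dh.pairing P P = Dh.pairing (.some x' y' h') (.some x' y' h') := by
    rw [← hnP, map_nsmul, map_nsmul, AddMonoidHom.nsmul_apply, smul_smul, nsmul_eq_mul]
    push_cast; ring
  rw [hsq]
  exact norm_pairing_self_sub_exactForm_le_of_isMultCanonical hW hq hDh hadm' h4'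

end Canonical

/-! ### §21 The uniform certificate schema -/

section Proxy

variable {W : WeierstrassCurve ℚ}

/-- **Certificate schema, exact second order.** For `W/ℚ` globally minimal, multiplicative at `3`, `‖q‖₃ < 1`,
a rational point `P = (x, y)` of level `≥ 2`, and ANY `κ̃ ∈ ℚ₃` with `‖κ̃ − κ_E‖₃ ≤ ‖x‖₃⁻¹` (a proxy of the
quasi-period constant to `2k` digits — e.g. `−κ₀'` when `ν ≥ 2k`, `−κ₀' − 60c₆Δ/c₄⁴` when `2ν ≥ 2k`, or any
longer rational truncation of the `q`-series): if `‖log₃ num x − κ̃·den x/num x‖₃ > ‖x‖₃⁻²` then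
**`‖ĥ₃(P)‖₃ = ‖log₃ num x − κ̃·den x/num x‖₃`** (in particular `ĥ₃(P) ≠ 0`). [cite: SteinWuthrich2013, §4.1 eq. (4.1), §4.2] -/
theorem norm_heightFourOneCoord_eq_of_proxy [W.IsElliptic] [W.IsGloballyMinimal] (hW : Mult W 3)
    {q : ℚ_[3]} (hq : ‖q‖ < 1) {x y : ℚ} (hxy : W.toAffine.Nonsingular x y) (hx : 1 < ‖(x : ℚ_[3])‖)
    (hz9 : ‖-(x : ℚ_[3]) / y‖ ≤ 1 / 9) {κ : ℚ_[3]}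
    (hκ : ‖κ - ((uniformisationScaleSq W 3 q)⁻¹ * (1 - 24 * tateS 1 q) - (W.baseChange ℚ_[3]).b₂) / 12‖
      ≤ ‖(x : ℚ_[3])‖⁻¹)
    (hbig : ‖(x : ℚ_[3])‖⁻¹ ^ 2 < ‖padicLog 3 ((x.num : ℚ) : ℚ_[3]) -
      κ * (((x.den : ℚ) : ℚ_[3]) / ((x.num : ℚ) : ℚ_[3]))‖) :
    ‖heightFourOneCoord W 3 q x y‖ =
      ‖padicLog 3 ((x.num : ℚ) : ℚ_[3]) - κ * (((x.den : ℚ) : ℚ_[3]) / ((x.num : ℚ) : ℚ_[3]))‖ := by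
  set X : ℚ_[3] := (x : ℚ_[3]) with hXdef
  set a : ℚ_[3] := ((x.num : ℚ) : ℚ_[3]) with hadef
  set D : ℚ_[3] := ((x.den : ℚ) : ℚ_[3]) with hDdef
  set κE : ℚ_[3] := ((uniformisationScaleSq W 3 q)⁻¹ * (1 - 24 * tateS 1 q) - (W.baseChange ℚ_[3]).b₂) / 12
    with hκEdef
  have hB := norm_heightFourOneCoord_sub_padicLog_num_add_kappaE_mul_le hW hq hxy hx hz9
  rw [← hXdef, ← hadef, ← hDdef, ← hκEdef] at hB
  have hX0n : 0 < ‖X‖ := one_pos.trans hx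
  have hnum : a = X * D := by rw [hadef, hXdef, hDdef, ← Rat.cast_mul, Rat.mul_den_eq_num]
  have hDn : ‖D‖ = ‖X‖⁻¹ := by rw [hDdef]; exact norm_den_eq_inv_norm hx
  have han : ‖a‖ = 1 := by rw [hnum, norm_mul, hDn, mul_inv_cancel₀ hX0n.ne']
  have hDa : ‖D / a‖ = ‖X‖⁻¹ := by rw [norm_div, han, div_one, hDn]
  have hdiff : ‖heightFourOneCoord W 3 q x y - (padicLog 3 a - κ * (D / a))‖ ≤ ‖X‖⁻¹ ^ 2 := by
    have e : heightFourOneCoord W 3 q x y - (padicLog 3 a - κ * (D / a)) =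
        (heightFourOneCoord W 3 q x y - padicLog 3 a + κE * (D / a)) + (κ - κE) * (D / a) := by ring
    rw [e]
    refine (norm_add_le_max _ _).trans (max_le hB ?_)
    rw [norm_mul, hDa, sq]
    exact mul_le_mul_of_nonneg_right hκ (inv_nonneg.mpr (norm_nonneg _))
  exact norm_eq_of_norm_sub_lt_right (lt_of_le_of_lt hdiff hbig)
  where
  /-- ultrametric: `‖u − v‖ < ‖v‖ ⟹ ‖u‖ = ‖v‖` -/
  norm_eq_of_norm_sub_lt_right {u v : ℚ_[3]} (huv : ‖u - v‖ < ‖v‖) : ‖u‖ = ‖v‖ :=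
    Padic.norm_eq_of_norm_sub_lt_right huv

/-- **Non-vanishing from a proxy.** Under the hypotheses of `norm_heightFourOneCoord_eq_of_proxy`:
`ĥ₃(P) ≠ 0`. At a higher multiple `3^m P` (level `k + m`, `v₃ ĥ₃(3^m P) = v₃ ĥ₃(P) + 2m`, precision `4(k+m)`)
every curve with `ĥ₃(P) ≠ 0` is certified this way from a rational approximation of `κ_E` to `2(k+m)` digits.
[cite: SteinWuthrich2013, §4.1 eq. (4.1), §4.2] -/
theorem heightFourOneCoord_ne_zero_of_proxy [W.IsElliptic] [W.IsGloballyMinimal] (hW : Mult W 3)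
    {q : ℚ_[3]} (hq : ‖q‖ < 1) {x y : ℚ} (hxy : W.toAffine.Nonsingular x y) (hx : 1 < ‖(x : ℚ_[3])‖)
    (hz9 : ‖-(x : ℚ_[3]) / y‖ ≤ 1 / 9) {κ : ℚ_[3]}
    (hκ : ‖κ - ((uniformisationScaleSq W 3 q)⁻¹ * (1 - 24 * tateS 1 q) - (W.baseChange ℚ_[3]).b₂) / 12‖
      ≤ ‖(x : ℚ_[3])‖⁻¹)
    (hbig : ‖(x : ℚ_[3])‖⁻¹ ^ 2 < ‖padicLog 3 ((x.num : ℚ) : ℚ_[3]) -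
      κ * (((x.den : ℚ) : ℚ_[3]) / ((x.num : ℚ) : ℚ_[3]))‖) :
    heightFourOneCoord W 3 q x y ≠ 0 := by
  intro h0
  have h := norm_heightFourOneCoord_eq_of_proxy hW hq hxy hx hz9 hκ hbig
  rw [h0, norm_zero] at h
  have : (0 : ℝ) < ‖padicLog 3 ((x.num : ℚ) : ℚ_[3]) - κ * (((x.den : ℚ) : ℚ_[3]) / ((x.num : ℚ) : ℚ_[3]))‖ :=
    lt_of_le_of_lt (by positivity) hbig
  linarith

end Proxy

end Summit.BirchSwinnertonDyer.Rank1Residual.X11b.RegMult.HeightLogNumerator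

end
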